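import Summits.KontsevichZagierPeriods.KontsevichZagierPeriods.Theorems.RootDecompWalshStrataCutBall4Base
import Literature.NumberTheory.Transcendental.KZDilationMove

/-!
# Root decomposition on Walsh strata — part 106 (gen 13): the pieces of the face-cut 4-ball

Crux `QuadricSignKernel` (item 25393), slice `d = 4`; the face-cut balls
`C_ρ = (0,1)⁴ ∩ {Σ xᵢ² < ρ}` (standard cells of `cutPoly ρ = ρ − Σ Xᵢ²`), `0 < ρ ≤ 2`.
This part is the SCISSORS bookkeeping of `[C_ρ, q]` inside the three Kontsevich–Zagier rules:

* the peeled orthants `B_i(ρ) = {x | xⱼ > 0, Σxⱼ² < ρ, xⱼ < 1 (j < i)}` (`bSet ρ i`, `bRep`), with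
  `B_0(ρ)` the positive orthant of the ball of radius `√ρ` and `B_4(ρ) = C_ρ`;
* rule (1a), one cap at a time: `B_i = B_{i+1} ⊔ K_i` for `ρ ≤ 2` (`bSet_eq_union`; the pieces
  are disjoint because a point of the orthant ball of radius `≤ √2` has at most one coordinate `≥ 1`),
  hence `[B_i, q] − [B_{i+1}, q] − [K_i, q] ∈ relations` (`of_bRep_sub_sub_mem_relations`);
* rule (2), a coordinate swap: `[K_0, q] ≡ [K_i, q]` (`of_capRep_zero_sub_of_capRep_mem_relations`);
* rule (2), the dilation `u ↦ √ρ·u`: `[unit ball cell, ρ²q] ≡ [B_0(ρ), q]`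
  (`of_ball4_cell_sub_of_bRep_zero_mem_relations`, via `KZ.smul_sub_mem_relations`).

Part 107 feeds these into the `π`-isotypic Baker sector. [KontsevichZagier2001 §1.2; BCR1998 §2.1]
-/

noncomputable section

open Literature.NumberTheory.Transcendental
open MeasureTheory Set
open MvPolynomial (aeval X C)
open Literature.ModelTheory.ExponentialFields (IsSemialgebraic isSemialgebraic_setOf_eval_pos
  isSemialgebraic_setOf_eval_nonneg isSemialgebraic_setOf_eval_lt)
open Summit.KontsevichZagierPeriods.RootDecompWalshStrata.WalshSpanProof (cellRep cellRep_domain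
  cellRep_integrand isSemialgebraic_cubeSet isBounded_cubeSet)
open Summit.KontsevichZagierPeriods.RootDecompWalshStrata.ConicDescent (bddRep bddRep_domain bddRep_integrand)
open Summit.KontsevichZagierPeriods.RootDecompWalshStrata.Ball4 (ball4Poly aeval_ball4Poly)

namespace Summit.KontsevichZagierPeriods.RootDecompWalshStrata.CutBall4

variable {ρ : ℚ}

/-! #### The face-cut ball polynomial -/

/-- `cutPoly ρ = ρ − X₀² − X₁² − X₂² − X₃²`; its standard cells are the face-cut balls `[C_ρ, q]`. -/
def cutPoly (ρ : ℚ) : MvPolynomial (Fin 4) ℚ := C ρ - X 0 ^ 2 - X 1 ^ 2 - X 2 ^ 2 - X 3 ^ 2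

/-- Evaluation of `cutPoly`. [definition] -/
@[simp] theorem aeval_cutPoly (x : Fin 4 → ℝ) :
    aeval x (cutPoly ρ) = (ρ : ℝ) - x 0 ^ 2 - x 1 ^ 2 - x 2 ^ 2 - x 3 ^ 2 := by
  simp [cutPoly]

/-- `cutPoly ρ` is a quadric. [elementary] -/
theorem totalDegree_cutPoly_le (ρ : ℚ) : (cutPoly ρ).totalDegree ≤ 2 := by
  unfold cutPoly
  refine (MvPolynomial.totalDegree_sub _ _).trans (max_le ?_ ?_)
  · refine (MvPolynomial.totalDegree_sub _ _).trans (max_le ?_ ?_)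
    · refine (MvPolynomial.totalDegree_sub _ _).trans (max_le ?_ ?_)
      · refine (MvPolynomial.totalDegree_sub _ _).trans (max_le ?_ ?_)
        · simp
        · simp [MvPolynomial.totalDegree_X_pow]
      · simp [MvPolynomial.totalDegree_X_pow]
    · simp [MvPolynomial.totalDegree_X_pow]
  · simp [MvPolynomial.totalDegree_X_pow]

/-- `nsq` as a `Finset` sum. [definition] -/
theorem nsq_eq_sum (x : Fin 4 → ℝ) : nsq x = ∑ j, x j ^ 2 := by
  simp [nsq, Fin.sum_univ_four]

/-- A single square is at most `nsq`. [elementary] -/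
private theorem sq_le_nsq (x : Fin 4 → ℝ) (j : Fin 4) : x j ^ 2 ≤ nsq x := by
  rw [nsq_eq_sum]
  exact Finset.single_le_sum (f := fun i => x i ^ 2) (fun i _ => sq_nonneg (x i)) (Finset.mem_univ j)

/-! #### The peeled orthants `B_i(ρ)` -/

/-- `B_i(ρ) = {x | xⱼ > 0 ∀ j, Σ xⱼ² < ρ, xⱼ < 1 for j < i}`: the positive orthant of the ball of
radius `√ρ` with the first `i` caps removed. -/
def bSet (ρ : ℚ) (i : ℕ) : Set (Fin 4 → ℝ) :=
  {x | ((∀ j, 0 < x j) ∧ nsq x < ρ) ∧ ∀ j : Fin 4, (j : ℕ) < i → x j < 1}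

/-- Membership in `B_i(ρ)`, unfolded. [definition] -/
theorem mem_bSet {i : ℕ} {x : Fin 4 → ℝ} :
    x ∈ bSet ρ i ↔ ((∀ j, 0 < x j) ∧ nsq x < ρ) ∧ ∀ j : Fin 4, (j : ℕ) < i → x j < 1 := Iff.rfl

/-- `B_i(ρ)` is `ℚ`-semialgebraic. [BCR1998 §2.1] -/
theorem isSemialgebraic_bSet (ρ : ℚ) (i : ℕ) : IsSemialgebraic ℚ (bSet ρ i) := by
  have h3 : IsSemialgebraic ℚ {x : Fin 4 → ℝ |
      aeval x (X 0 ^ 2 + X 1 ^ 2 + X 2 ^ 2 + X 3 ^ 2 : MvPolynomial (Fin 4) ℚ) <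
        aeval x (C ρ : MvPolynomial (Fin 4) ℚ)} :=
    isSemialgebraic_setOf_eval_lt _ _
  have h4 := IsSemialgebraic.biInter (k := ℚ) (R := ℝ)
    ((Finset.univ : Finset (Fin 4)).filter fun j : Fin 4 => j.val < i)
    (fun a => {t : Fin 4 → ℝ | aeval t (X a : MvPolynomial (Fin 4) ℚ) <
      aeval t (1 : MvPolynomial (Fin 4) ℚ)})
    (fun a _ => isSemialgebraic_setOf_eval_lt _ _)
  convert (isSemialgebraic_posSet.inter h3).inter h4 using 1
  ext x
  simp only [bSet, nsq, mem_inter_iff, mem_setOf_eq, mem_iInter, Finset.mem_filter,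
    Finset.mem_univ, true_and, map_add, map_pow, map_one, MvPolynomial.aeval_X,
    MvPolynomial.aeval_C, eq_ratCast]

/-- `B_i(ρ) ⊆ [0, 2]⁴` for `ρ ≤ 2`. [folklore] -/
theorem bSet_subset_Icc (h2 : ρ ≤ 2) (i : ℕ) : bSet ρ i ⊆ Icc 0 2 := by
  intro x hx
  obtain ⟨⟨hpos, hn⟩, -⟩ := hx
  have h2' : (ρ : ℝ) ≤ 2 := by exact_mod_cast h2
  refine ⟨fun j => (hpos j).le, fun j => ?_⟩
  have hj := sq_le_nsq x j
  change x j ≤ 2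
  nlinarith [hpos j]

/-- `B_i(ρ)` is bounded. [folklore] -/
theorem isBounded_bSet (h2 : ρ ≤ 2) (i : ℕ) : Bornology.IsBounded (bSet ρ i) :=
  (isCompact_Icc (a := (0 : Fin 4 → ℝ)) (b := 2)).isBounded.subset (bSet_subset_Icc h2 i)

/-- **`bRep ρ q i = [B_i(ρ), q]`**, constant rational weight `q` (`ρ ≤ 2`). [KontsevichZagier2001 §1.1] -/
def bRep (ρ q : ℚ) (h2 : ρ ≤ 2) (i : ℕ) : KZ.IntegralRep 4 :=
  bddRep (bSet ρ i) (isSemialgebraic_bSet ρ i) (isBounded_bSet h2 i) (fun _ => (q : ℝ))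
    (isSemialgebraicFunOn_ratCast (isSemialgebraic_bSet ρ i) q) |(q : ℝ)| fun _ _ => le_rfl

/-- The domain of `bRep`. [definition] -/
@[simp] theorem bRep_domain (q : ℚ) (h2 : ρ ≤ 2) (i : ℕ) : (bRep ρ q h2 i).domain = bSet ρ i := rfl

/-- The integrand of `bRep`. [definition] -/
@[simp] theorem bRep_integrand (q : ℚ) (h2 : ρ ≤ 2) (i : ℕ) (x : Fin 4 → ℝ) :
    (bRep ρ q h2 i).integrand x = (q : ℝ) := rfl

/-! #### Rule (1a): peeling one cap, `B_i = B_{i+1} ⊔ K_i` -/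

/-- In the ball of radius `≤ √2`, a point with `x_i ≥ 1` has all other coordinates `< 1`.
[elementary] -/
theorem lt_one_of_one_le {x : Fin 4 → ℝ} (h2 : ρ ≤ 2) (hn : nsq x < ρ)
    {i j : Fin 4} (hi : 1 ≤ x i) (hne : j ≠ i) : x j < 1 := by
  have h2' : (ρ : ℝ) ≤ 2 := by exact_mod_cast h2
  have hpair : x j ^ 2 + x i ^ 2 ≤ nsq x := by
    rw [nsq_eq_sum, ← Finset.sum_pair (f := fun k => x k ^ 2) hne]
    exact Finset.sum_le_sum_of_subset_of_nonneg (Finset.subset_univ _) fun k _ _ => sq_nonneg (x k)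
  nlinarith

/-- **`B_i(ρ) = B_{i+1}(ρ) ∪ K_i(ρ)`** for `ρ ≤ 2`. [elementary] -/
theorem bSet_eq_union (h2 : ρ ≤ 2) (i : Fin 4) :
    bSet ρ i = bSet ρ ((i : ℕ) + 1) ∪ capSet ρ i := by
  ext x
  simp only [mem_bSet, mem_union, mem_capSet]
  constructor
  · rintro ⟨⟨hpos, hn⟩, hlt⟩
    by_cases hi : x i < 1
    · refine Or.inl ⟨⟨hpos, hn⟩, fun j hj => ?_⟩
      rcases Nat.lt_succ_iff_lt_or_eq.1 hj with hj | hj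
      · exact hlt j hj
      · rw [Fin.ext hj]; exact hi
    · exact Or.inr ⟨hpos, not_lt.1 hi, hn⟩
  · rintro (⟨⟨hpos, hn⟩, hlt⟩ | ⟨hpos, hi, hn⟩)
    · exact ⟨⟨hpos, hn⟩, fun j hj => hlt j (Nat.lt_succ_of_lt hj)⟩
    · refine ⟨⟨hpos, hn⟩, fun j hj => ?_⟩
      have hne : j ≠ i := fun h => by rw [h] at hj; exact lt_irrefl _ hj
      exact lt_one_of_one_le h2 hn hi hne

/-- The two pieces are disjoint. [elementary] -/
theorem bSet_succ_inter_capSet (ρ : ℚ) (i : Fin 4) : bSet ρ ((i : ℕ) + 1) ∩ capSet ρ i = ∅ :=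
  Set.eq_empty_iff_forall_notMem.2 fun _ ⟨hb, hc⟩ =>
    (not_lt.2 hc.2.1) (hb.2 i (Nat.lt_succ_self _))

/-- **Rule (1a): `[B_i, q] − [B_{i+1}, q] − [K_i, q] ∈ relations`** (`ρ ≤ 2`).
[KontsevichZagier2001 §1.2 rule (1)] -/
theorem of_bRep_sub_sub_mem_relations (q : ℚ) (h2 : ρ ≤ 2) (i : Fin 4) :
    KZ.of (bRep ρ q h2 i) - KZ.of (bRep ρ q h2 ((i : ℕ) + 1)) - KZ.of (capRep ρ q h2 i) ∈
      KZ.relations :=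
  KZ.domainAddRel_subset_relations ⟨4, bRep ρ q h2 i, bRep ρ q h2 ((i : ℕ) + 1), capRep ρ q h2 i,
    by rw [bRep_domain, bRep_domain, capRep_domain]; exact bSet_eq_union h2 i,
    by rw [bRep_domain, capRep_domain, bSet_succ_inter_capSet]; exact measure_empty,
    fun _ _ => rfl, fun _ _ => rfl, rfl⟩

/-- `B_4(ρ) = C_ρ`, the standard cell of `cutPoly ρ`. [definition] -/
theorem cellRep_cutPoly_domain (ρ q : ℚ) : (cellRep (cutPoly ρ) q).domain = bSet ρ 4 := by
  ext x
  rw [cellRep_domain]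
  simp only [mem_setOf_eq, mem_bSet, aeval_cutPoly, nsq]
  constructor
  · rintro ⟨hx, hP⟩
    exact ⟨⟨fun j => (hx j).1, by linarith⟩, fun j _ => (hx j).2⟩
  · rintro ⟨⟨hpos, hn⟩, hlt⟩
    exact ⟨fun j => ⟨hpos j, hlt j j.2⟩, by linarith⟩

/-- `[B_4(ρ), q] ≡ [C_ρ, q]` (same domain and integrand). [KontsevichZagier2001 §1.2] -/
theorem of_bRep_four_sub_of_cellRep_mem_relations (q : ℚ) (h2 : ρ ≤ 2) :
    KZ.of (bRep ρ q h2 4) - KZ.of (cellRep (cutPoly ρ) q) ∈ KZ.relations :=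
  KZ.of_sub_of_mem_relations_of_eqOn (cellRep_cutPoly_domain ρ q)
    fun x _ => by rw [bRep_integrand, cellRep_integrand]

/-! #### Rule (2): the caps are congruent, `K_i ≅ K_0` -/

/-- The coordinate swap `(0 i)` carries `K_i(ρ)` onto `K_0(ρ)`. [elementary] -/
theorem comp_swap_mem_capSet_iff (i : Fin 4) (w : Fin 4 → ℝ) :
    (fun j => w (Equiv.swap 0 i j)) ∈ capSet ρ 0 ↔ w ∈ capSet ρ i := by
  have hs : ∑ j, w (Equiv.swap 0 i j) ^ 2 = ∑ j, w j ^ 2 :=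
    Equiv.sum_comp (Equiv.swap 0 i) (fun j => w j ^ 2)
  simp only [mem_capSet, Equiv.swap_apply_left, nsq_eq_sum, hs]
  exact and_congr_left fun _ =>
    ⟨fun h j => by simpa using h (Equiv.swap 0 i j), fun h j => h _⟩

/-- The reindexed cap `capRep … 0 ∘ (0 i)` has domain `K_i(ρ)`. [definition] -/
theorem reindex_capRep_zero_domain (q : ℚ) (h2 : ρ ≤ 2) (i : Fin 4) :
    ((capRep ρ q h2 0).reindex (Equiv.swap 0 i)).domain = capSet ρ i := by
  ext w
  rw [KZ.IntegralRep.reindex_domain, capRep_domain, mem_setOf_eq]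
  exact comp_swap_mem_capSet_iff i w

/-- **Rule (2), coordinate swap: `[K_0(ρ), q] − [K_i(ρ), q] ∈ relations`.**
[KontsevichZagier2001 §1.2 rule (2)] -/
theorem of_capRep_zero_sub_of_capRep_mem_relations (q : ℚ) (h2 : ρ ≤ 2) (i : Fin 4) :
    KZ.of (capRep ρ q h2 0) - KZ.of (capRep ρ q h2 i) ∈ KZ.relations := by
  have h1 := KZ.of_sub_of_reindex_mem_relations (capRep ρ q h2 0) (Equiv.swap 0 i)
  have h2' : KZ.of ((capRep ρ q h2 0).reindex (Equiv.swap 0 i)) - KZ.of (capRep ρ q h2 i) ∈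
      KZ.relations :=
    KZ.of_sub_of_mem_relations_of_eqOn
      (by rw [reindex_capRep_zero_domain, capRep_domain]) fun w _ => rfl
  have := add_mem h1 h2'
  rwa [sub_add_sub_cancel] at this

/-! #### Rule (2): the dilation `u ↦ √ρ·u` -/

/-- `√ρ` is algebraic. [elementary] -/
theorem isAlgebraic_sqrt (hρ : 0 ≤ ρ) : IsAlgebraic ℚ (√(ρ : ℝ)) :=
  IsAlgebraic.of_pow two_pos
    (by rw [Real.sq_sqrt (by exact_mod_cast hρ)]; exact isAlgebraic_algebraMap ρ)

/-- The dilation by `√ρ` carries the unit ball cell onto `B_0(ρ)` (`0 < ρ`). [elementary] -/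
theorem image_smul_ball4_cell (hρ : 0 < ρ) (w : ℚ) :
    (fun u : Fin 4 → ℝ => √(ρ : ℝ) • u) '' (cellRep ball4Poly w).domain = bSet ρ 0 := by
  have hρ' : (0 : ℝ) < ρ := by exact_mod_cast hρ
  have hs : 0 < √(ρ : ℝ) := Real.sqrt_pos.2 hρ'
  have hsq : √(ρ : ℝ) ^ 2 = ρ := Real.sq_sqrt hρ'.le
  ext x
  rw [cellRep_domain]
  constructor
  · rintro ⟨u, ⟨hu, hP⟩, rfl⟩
    rw [aeval_ball4Poly] at hP
    refine ⟨⟨fun j => ?_, ?_⟩, fun j hj => absurd hj (Nat.not_lt_zero _)⟩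
    · simpa only [Pi.smul_apply, smul_eq_mul] using mul_pos hs (hu j).1
    · have e : nsq (√(ρ : ℝ) • u) = (ρ : ℝ) * (u 0 ^ 2 + u 1 ^ 2 + u 2 ^ 2 + u 3 ^ 2) := by
        simp only [nsq, Pi.smul_apply, smul_eq_mul, mul_pow, hsq]; ring
      rw [e]
      nlinarith
  · rintro ⟨⟨hpos, hn⟩, -⟩
    refine ⟨fun j => x j / √(ρ : ℝ), ⟨fun j => ⟨div_pos (hpos j) hs, ?_⟩, ?_⟩, ?_⟩
    · rw [div_lt_one hs, Real.lt_sqrt (hpos j).le]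
      exact (sq_le_nsq x j).trans_lt hn
    · have e : ∀ j, (x j / √(ρ : ℝ)) ^ 2 = x j ^ 2 / ρ := fun j => by rw [div_pow, hsq]
      rw [aeval_ball4Poly, e, e, e, e]
      have h : nsq x / ρ < 1 := (div_lt_one hρ').2 hn
      have e' : x 0 ^ 2 / (ρ : ℝ) + x 1 ^ 2 / ρ + x 2 ^ 2 / ρ + x 3 ^ 2 / ρ = nsq x / ρ := by
        rw [nsq]; ring
      linarith
    · ext j
      simp only [Pi.smul_apply, smul_eq_mul]
      rw [mul_div_cancel₀ _ hs.ne']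

/-- **Rule (2), dilation: `[unit ball cell, ρ²·q] − [B_0(ρ), q] ∈ relations`** (`0 < ρ ≤ 2`;
Jacobian `|√ρ|⁴ = ρ²`). [KontsevichZagier2001 §1.2 rule (2)] -/
theorem of_ball4_cell_sub_of_bRep_zero_mem_relations (hρ : 0 < ρ) (h2 : ρ ≤ 2) (q : ℚ) :
    KZ.of (cellRep ball4Poly (ρ ^ 2 * q)) - KZ.of (bRep ρ q h2 0) ∈ KZ.relations := by
  have hρ' : (0 : ℝ) < ρ := by exact_mod_cast hρ
  have hs : 0 < √(ρ : ℝ) := Real.sqrt_pos.2 hρ'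
  have h4 : √(ρ : ℝ) ^ 4 = (ρ : ℝ) ^ 2 := by
    rw [show (4 : ℕ) = 2 * 2 from rfl, pow_mul, Real.sq_sqrt hρ'.le]
  refine KZ.smul_sub_mem_relations (isAlgebraic_sqrt hρ.le) hs.ne' _ _
    (by rw [bRep_domain, image_smul_ball4_cell hρ]) fun x _ => ?_
  rw [cellRep_integrand, bRep_integrand, abs_of_nonneg hs.le, h4]
  push_cast
  ring

end Summit.KontsevichZagierPeriods.RootDecompWalshStrata.CutBall4

end
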